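import Summits.QuantumFields.YangMills.Theorems.BalabanUVNodesN11Sect3SupplyChainNode
import Literature.MathematicalPhysics.QuantumFieldTheory.Balaban1983to89.Node00.Record13NumericsOfThm1CCMW

/-!
# DAG node N11 — THE NODE ALONG THE CHAIN AT EVERY STAGE-13 LIVE RE-PIN, AT K0a's ALL-NUMERICS WITNESS FAMILY `theta13LiveOfNumerics n ε₂₉`, AND AT K1's WITNESS OF RECORD
# `θ₁₅ᶜᶜᴹᵂ(j; γ) = theta13OfThm1CCMW F N j γ ε₀ ε₂₉ B₃ B₃' a₀ a₁`: [III]'s Theorem of p. 245 in law form — EXACTLY the `hT` binder of dag-n24-c's split-closer supplier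
# `N24_h11_theta13OfThm1CCMW_of_thmP245_laws` — supplied BY NAME from `hrec` + N11's one-token residual `SupplyChainAt` (+ the rows ∕ Gaussian-certificate editions), every
# live-selector side condition DISCHARGED; and N11's node `Dag.B14_main` at EVERY world bound to the datum, ceiling letter `βup` and window `γ` UNREAD

Cell `pub-ymgap`, YM-PLAN Track A (HUMAN RULING D-0062 ∕ D-0149), seat `pub-ymgap-dag-n11-e` (g19; R134 fan-out row N11∕s3 «`ThmP245Printed` :375 via `rOperation`»), route
`BalabanUVNodes` rev 25 (v1.7 `CoPH` key), item K1⁷ `StabilityBAtRecordR13SepCoPH` = stmt-QuantumFields-20542 (helper lane `--supports`, count-neutral).  [III] = [Balaban1988Convergent],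
[IV] = [Balaban1989LargeFieldI], [B16] = [Balaban1989LargeFieldII].  Over this seat's p596032 `…N11Sect3SupplyChainNode` ∕ p595576 `…ObligationsDefs` (the generic-`θ` faces on the
live-selector line: `sLaw₁₃CoPH_all_of_obligations`, `tLaw₁₃CoPH_all_of_obligations`, `thmP245Laws_of_obligations ∕ _of_supplyChainAt`, `thmP245PrintedI_of_obligations`,
`b14_main_of_obligations`, §5 `noExpansionObligation_of_residualRows_of_operandRows ∕ _of_gaussCert_of_operandRows`), this seat's `B16RLeafRecord13AtLive.liveRepin₁₃_liveSel` and
`Stage13Params.Admissible.liveRepin₁₃`, node00-def-K0a's `Record13LiveSelectorFamily` (`theta13OfNumerics ∕ theta13LiveOfNumerics`, `admissible_theta13OfNumerics`) and dag-n21-c's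
`Record13NumericsOfThm1CCMW` (`theta13OfThm1CCMW`, `stage12NumericsOfThm1CCMW_pos_of_le_half`, `stage12NumericsOfThm1CCMW_τ9_M`).

WHY THIS FILE (HOME TRIGGERS (t65)).  dag-n24-c g9's split closers of K1⁷ (INTENT-43, `…N24ChildrenSplitN07N11N13Suppliers` §1 `N24_h11_theta13OfThm1CCMW_of_thmP245_laws`) key N11's
TYPE `h11` at K1's witness of record `θᴴ := Stage13HParams.ofHistoryBlind F N ⟨theta13OfThm1CCMW F N j γ ε₀ ε₂₉ B₃ B₃' a₀ a₁, ZrOfRecord₁₃ F N (…)⟩` on ONE binder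
`hT : ∀ P k, k < P.K → SLaw₁₃CoPH θᴴ P k → TLaw₁₃CoPH θᴴ P k` — [III]'s Theorem of p. 245 in the sequence reading along every run.  p596032 §3 read the chain road only at the
H-extensions of `theta13LiveOfRecord F N`.  Here the same road is read (§1) at ANY `θ : Stage13HParams` whose Stage-13 part is a LIVE RE-PIN `θ₀.liveRepin₁₃ F N` (selector clause
`rfl`, admissibility `hθ₀.liveRepin₁₃`; the three term-constant signs and `1 ≤ M` read off `θ₀`), (§2) at K0a's all-numerics family `theta13LiveOfNumerics F N n ε₂₉ ζ Rz Zt` (`n.Pos`,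
`0 < ε₂₉`), and (§3) at `θ₁₅ᶜᶜᴹᵂ(j; γ)` from the window `0 < γ ≤ ½` and the six admissibility signs ALONE — `κ = 2·10⁴`, `E₀ = B₀ = 1`, `M = L^j ≥ 1` are numerals — concluding the `hT`
binder VERBATIM at `Stage13HParams.ofHistoryBlind F N ⟨θ₁₅ᶜᶜᴹᵂ, Zr⟩` (any `Zr`; dag-n24-c takes `Zr := ZrOfRecord₁₃ F N θ₁₅ᶜᶜᴹᵂ`).  Every theorem is keyed by the EQUATION
`hθ : θ.toStage13Params = …`, so any presentation of the H-extension (tuple, `ofHistoryBlind`, a Gaussian re-pin with the same Stage-13 part) instantiates with `hθ := rfl`.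
THE CEILING LETTER (ym-nodeO CRIT-1 g4 on idea `k1-ceiling-before-world` ed.2, `N11CU`): on this road N11's node `Dag.B14_main (leavesP w P)` reads of the world `w` ONLY the
binding `w.C = datum.C` — `βup`, `β₀`, `γ`, `b`, `L`, `up` are NOT read (`b14_main_…` below) —, so the re-lettered binding `{w with βup := c, γ := γ'}` costs on the chain road
exactly what `w` costs: the same `SupplyChainAt θ P`.  (`N11CU` itself is the plan's word and is not imported or restated here.)

WHAT THIS FILE PROVES (0 `def`, 0 `sorry`, standard axioms; every proof destructures `θ`, substitutes `hθ`, and is ONE application of a p596032 ∕ p595576 face).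
§1 (live re-pin `θ₀.liveRepin₁₃`) `sLaw₁₃CoPH_all_liveRepinH_of_obligations` · `tLaw₁₃CoPH_all_liveRepinH_of_obligations` · `thmP245Laws_all_liveRepinH_of_supplyChainAt` (the `hT`
   binder, all runs) · `b14_main_liveRepinH_of_obligations` (every world bound to the datum) · `sLaw₁₃CoPH_all_liveRepinH_of_obligations_of_rows` ·
   `sLaw₁₃CoPH_all_liveRepinH_gaussCert_of_obligations_of_operandRows` · `thmP245PrintedI_liveRepinH_of_obligations` (AS PRINTED, this seat's R134 row; dag-n24-c §2's `h245` per run).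
§2 (all-numerics family) the same seven with infix `theta13LiveOfNumericsH`.
§3 (K1's witness `θ₁₅ᶜᶜᴹᵂ(j; γ)`) the same seven with infix `theta13OfThm1CCMWH` (+ the numeral `one_le_M_stage12NumericsOfThm1CCMW`) + ★
   `thmP245Laws_all_ofHistoryBlind_theta13OfThm1CCMW_of_supplyChainAt` ∕ `…_of_obligations_of_rows` — dag-n24-c 34H §1's `hT` binder at the literal
   `Stage13HParams.ofHistoryBlind F N ⟨θ₁₅ᶜᶜᴹᵂ, Zr⟩` (§3b) —, and ★★★ `sLaw₁₃CoPH_all_ ∕ thmP245Laws_all_gaussPinH_theta13OfThm1CCMWH_of_obligations_of_operandRows` (§3c): at dag-n11-w1's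
   named Gaussian certificate `gaussPinH θ` of any H-extension of `θ₁₅ᶜᶜᴹᵂ` the no-expansion half is DISCHARGED from def-T's operand rows — N11's K1-facing residual there is `hrec` +
   `SupplierObligations` + `OperandRowsAlongChain`, nothing else.

HONEST FRAMING.  Count-neutral kernel composition BY NAME; `SupplierObligations` ([III] §3 ∕ Thm 2 — nobody's theorem yet), `NoExpansionObligation` ∕ `ResidualRows` ∕
`OperandRowsAlongChain` ∕ the Gaussian certificate and `hrec` are DISPLAYED, never discharged; nothing of Bałaban asserted; N11 NOT discharged; K1⁷ NOT closed; no stub closed; counts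
unmoved (typed 28∕28 · discharged 5∕27).  One finite `𝕋⁴_{L^K}` programme at fixed `ε = L^{−K}`; R4 closes only the conditional finite-𝕋⁴ rung `BalabanLadder.UV` — NOT ℝ⁴, NOT OS,
NOT a mass gap, NOT Clay.  No `sorry`, `axiom`, `def`, `instance`, `notation`.
Sources: [III] Theorem p.245, Thm 1 p.262, remark p.262, Thm 2 p.263, §3 p.279, (3.24)–(3.25) p.270, (3.23) p.270, (3.16)–(3.22) pp.268–269, (2.4)–(2.6) p.255, (2.10) p.256, (1.11) p.248,
p.244 L36–38; [IV] (0.2)–(0.4) p.176, p.177 (i)–(ii); [B16] Thm 1 p.355 (bookkeeping); [Balaban1987RG1] Thm 1 p.259 (the window letter).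
-/

noncomputable section

open MeasureTheory
open scoped BigOperators ENNReal NNReal Matrix.Norms.L2Operator

namespace Summit.QuantumFields.YangMills.Theorems.BalabanUVNodesN11Sect3SupplyChainNodeAtNumerics

open Literature.MathematicalPhysics.QuantumFieldTheory.Balaban1983to89 T4Continuum Node00 Node00.Tk DagBinding
open B10Eq42TorusConstraint (bondsIn)
open BalabanUVNodesN11HistoryPinnedResidualDefs (ZhPinOfRecord₁₃)
open BalabanUVNodesN11Sect3SupplyChainDefs (Sect3Supplier)
open BalabanUVNodesN11Sect3SupplyChainObligationsDefs
open BalabanUVNodesN11Sect3SupplyChainNode (thmP245PrintedI_of_obligations b14_main_of_obligations)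
open BalabanUVNodesN11GaussianCertificateDefs (gaussPinH gaussPinH_ζ0 gaussPinH_quad provisos₁₃CoPH_gaussPinH)

variable {F : T4Family} {N : ℕ} [NeZero N]

/-! ## §1  At any H-extension of a Stage-13 LIVE RE-PIN `θ₀.liveRepin₁₃ F N`: selector clause `rfl`, admissibility `hθ₀.liveRepin₁₃`; signs and `1 ≤ M` read off `θ₀` -/

section Repin

variable {θ₀ : Stage13Params F N} {θ : Stage13HParams F N} {p : B12.RunParams}

/-- **★ THEOREM 1 OF [III], ALL LEVELS `k ≤ K`, ALL HISTORIES, AT ANY `θ : Stage13HParams` WHOSE STAGE-13 PART IS A LIVE RE-PIN `θ₀.liveRepin₁₃ F N`** — from `hrec` (core provisos of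
`θ`, the datum's key), the supplier's obligations along its own chain `hσ` and the no-expansion obligation `hT`; the selector clause is `rfl` at the re-pin, admissibility is
`hθ₀.liveRepin₁₃`, the three term-constant signs and `1 ≤ M` are `θ₀`'s. [cite: Balaban1988Convergent, Thm 1 p.262, Theorem p.245, §3 p.279, (3.24)–(3.25) p.270, (3.22) p.269; Balaban1989LargeFieldI, (0.3)–(0.4) p.176, p.177 (i)–(ii)] -/
theorem sLaw₁₃CoPH_all_liveRepinH_of_obligations (hθ : θ.toStage13Params = θ₀.liveRepin₁₃ F N) (hθ₀ : θ₀.Admissible F N)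
    (hκ : 0 ≤ θ₀.s2.lf.κ) (hE₀ : 0 ≤ θ₀.s2.lf.E₀) (hB₀ : 0 ≤ θ₀.s2.lf.B₀) (hM : 1 ≤ θ₀.τ9.M) (hrec : θ.Provisos₁₃CoPH F N) (σ : Sect3Supplier θ p)
    (hσ : SupplierObligations θ p σ) (hT : NoExpansionObligation θ p σ) : ∀ k, k ≤ p.K → SLaw₁₃CoPH F N θ p k := by
  obtain ⟨⟨θ₁, Zr⟩, Zh, Phih⟩ := θ
  obtain rfl : θ₁ = _ := hθ
  exact sLaw₁₃CoPH_all_of_obligations hrec rfl hθ₀.liveRepin₁₃ hκ hE₀ hB₀ hM σ hσ hT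

/-- **★ THE 𝐓-IMAGES `∀ k < K, TLaw₁₃CoPH θ p k` AT ANY H-EXTENSION OF A LIVE RE-PIN** from `hrec`, `hσ`, `hT`. [cite: Balaban1988Convergent, Theorem p.245, remark p.262, §3 p.279, (3.25) p.270; Balaban1989LargeFieldI, (0.3)–(0.4) p.176] -/
theorem tLaw₁₃CoPH_all_liveRepinH_of_obligations (hθ : θ.toStage13Params = θ₀.liveRepin₁₃ F N) (hθ₀ : θ₀.Admissible F N)
    (hκ : 0 ≤ θ₀.s2.lf.κ) (hE₀ : 0 ≤ θ₀.s2.lf.E₀) (hB₀ : 0 ≤ θ₀.s2.lf.B₀) (hM : 1 ≤ θ₀.τ9.M) (hrec : θ.Provisos₁₃CoPH F N) (σ : Sect3Supplier θ p)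
    (hσ : SupplierObligations θ p σ) (hT : NoExpansionObligation θ p σ) : ∀ k, k < p.K → TLaw₁₃CoPH F N θ p k := by
  obtain ⟨⟨θ₁, Zr⟩, Zh, Phih⟩ := θ
  obtain rfl : θ₁ = _ := hθ
  exact tLaw₁₃CoPH_all_of_obligations hrec rfl hθ₀.liveRepin₁₃ hκ hE₀ hB₀ hM σ hσ hT

/-- **★★ THE THEOREM OF p. 245 IN LAW FORM ALONG EVERY RUN — dag-n24-c's `hT` binder `∀ P k, k < P.K → SLaw₁₃CoPH θ P k → TLaw₁₃CoPH θ P k` — AT ANY H-EXTENSION OF A LIVE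
RE-PIN, FROM `hrec` AND N11's ONE-TOKEN RESIDUAL `SupplyChainAt θ P` AT EVERY RUN** (∃ supplier with `SupplierObligations` ([III] §3) ∧ `NoExpansionObligation`).
[cite: Balaban1988Convergent, Theorem p.245, Thm 1 p.262, remark p.262, §3 p.279; Balaban1989LargeFieldI, (0.3)–(0.4) p.176] -/
theorem thmP245Laws_all_liveRepinH_of_supplyChainAt (hθ : θ.toStage13Params = θ₀.liveRepin₁₃ F N) (hθ₀ : θ₀.Admissible F N)
    (hκ : 0 ≤ θ₀.s2.lf.κ) (hE₀ : 0 ≤ θ₀.s2.lf.E₀) (hB₀ : 0 ≤ θ₀.s2.lf.B₀) (hM : 1 ≤ θ₀.τ9.M) (hrec : θ.Provisos₁₃CoPH F N)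
    (hN : ∀ P : B12.RunParams, SupplyChainAt θ P) :
    ∀ (P : B12.RunParams) (k : ℕ), k < P.K → SLaw₁₃CoPH F N θ P k → TLaw₁₃CoPH F N θ P k := by
  obtain ⟨⟨θ₁, Zr⟩, Zh, Phih⟩ := θ
  obtain rfl : θ₁ = _ := hθ
  exact fun P => thmP245Laws_of_supplyChainAt hrec rfl hθ₀.liveRepin₁₃ hκ hE₀ hB₀ hM (hN P)

/-- **★ N11's NODE `Dag.B14_main (leavesP w p)` AT EVERY WORLD `w` BOUND TO THE DATUM OF AN H-EXTENSION OF A LIVE RE-PIN — THE WORLD's LETTERS `βup`, `β₀`, `γ`, `b`, `L`, `up`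
UNREAD** (only `w.C = datum.C`): from `hrec`, `hσ`, `hT` (the 𝐑-leaf is CLOSED on the live line by p596032's `b14_main_of_obligations`).  In particular the node holds at every
re-lettered binding `{w with βup := c, γ := γ'}` at the same cost (CRIT-1's `N11CU` reading). [cite: Balaban1988Convergent, Thm 1 p.262, Theorem p.245, p.244 L36–38, (2.6) p.255; Balaban1989LargeFieldII, Thm 1 p.355 (bookkeeping)] -/
theorem b14_main_liveRepinH_of_obligations (hθ : θ.toStage13Params = θ₀.liveRepin₁₃ F N) (hθ₀ : θ₀.Admissible F N)
    (hκ : 0 ≤ θ₀.s2.lf.κ) (hE₀ : 0 ≤ θ₀.s2.lf.E₀) (hB₀ : 0 ≤ θ₀.s2.lf.B₀) (hM : 1 ≤ θ₀.τ9.M) (hrec : θ.Provisos₁₃CoPH F N) (σ : Sect3Supplier θ p)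
    (hσ : SupplierObligations θ p σ) (hT : NoExpansionObligation θ p σ) (w : WorldP) (hC : w.C = (datumOfRecord₁₃CoPH F N θ hrec).C) :
    Dag.B14_main (leavesP w p) := by
  obtain ⟨⟨θ₁, Zr⟩, Zh, Phih⟩ := θ
  obtain rfl : θ₁ = _ := hθ
  exact b14_main_of_obligations hrec rfl hθ₀.liveRepin₁₃ hκ hE₀ hB₀ hM σ hσ hT w hC

/-- **★ THEOREM 1 OF [III] AT ANY H-EXTENSION OF A LIVE RE-PIN FROM `hrec`, `ZhUnity`, THE SUPPLIER's OBLIGATIONS AND THE ROWS** (`ResidualRows` witness-free — pins,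
measurability, K0b's A-fibre domination; `OperandRowsAlongChain` — def-T): the no-expansion obligation DISCHARGED by p595576 §5. [cite: Balaban1988Convergent, Thm 1 p.262, Theorem p.245, (3.24)–(3.25) p.270, (3.16)–(3.22) pp.268–269, (1.11) p.248; Balaban1989LargeFieldI, (0.3)–(0.4) p.176] -/
theorem sLaw₁₃CoPH_all_liveRepinH_of_obligations_of_rows (hθ : θ.toStage13Params = θ₀.liveRepin₁₃ F N) (hθ₀ : θ₀.Admissible F N)
    (hκ : 0 ≤ θ₀.s2.lf.κ) (hE₀ : 0 ≤ θ₀.s2.lf.E₀) (hB₀ : 0 ≤ θ₀.s2.lf.B₀) (hM : 1 ≤ θ₀.τ9.M) (hrec : θ.Provisos₁₃CoPH F N) (hU : θ.ZhUnity F N)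
    (σ : Sect3Supplier θ p) (hσ : SupplierObligations θ p σ) (hres : ResidualRows θ p) (hops : OperandRowsAlongChain θ p σ) :
    ∀ k, k ≤ p.K → SLaw₁₃CoPH F N θ p k := by
  obtain ⟨⟨θ₁, Zr⟩, Zh, Phih⟩ := θ
  obtain rfl : θ₁ = _ := hθ
  exact sLaw₁₃CoPH_all_of_obligations hrec rfl hθ₀.liveRepin₁₃ hκ hE₀ hB₀ hM σ hσ
    (noExpansionObligation_of_residualRows_of_operandRows hrec hU hM σ hσ.loc hres hops)

/-- **★★ THEOREM 1 OF [III] AT ANY H-EXTENSION OF A LIVE RE-PIN IN THE GAUSSIAN-CERTIFICATE CLASS** (`Zh` carries the certificate's `ζ0` and the A-fibre Gaussian `quad`, e.g.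
dag-n11-w1's `gaussPinH`): from `hrec`, `SupplierObligations` and `OperandRowsAlongChain` — NOTHING of the no-expansion lane (no `ZhUnity`, no residual row, no K0b row).
[cite: Balaban1988Convergent, Thm 1 p.262, Theorem p.245, (3.23)–(3.25) p.270, (1.11) p.248, (2.23) p.258; Balaban1989LargeFieldI, (0.3)–(0.4) p.176] -/
theorem sLaw₁₃CoPH_all_liveRepinH_gaussCert_of_obligations_of_operandRows (hθ : θ.toStage13Params = θ₀.liveRepin₁₃ F N) (hθ₀ : θ₀.Admissible F N)
    (hκ : 0 ≤ θ₀.s2.lf.κ) (hE₀ : 0 ≤ θ₀.s2.lf.E₀) (hB₀ : 0 ≤ θ₀.s2.lf.B₀) (hM : 1 ≤ θ₀.τ9.M)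
    (hζ : ∀ (q : B12.RunParams) (m : ℕ) (Ω Λ : ℕ → Set (Site (F.P q.K) 0)), (θ.Zh q m Ω Λ).ζ0 = (ZhPinOfRecord₁₃ θ.toStage13Params q Ω Λ).ζ0)
    (hq : ∀ (q : B12.RunParams) (m : ℕ) (Ω Λ : ℕ → Set (Site (F.P q.K) 0)) (j : ℕ) (Λ' : Set (Site (F.P q.K) 0)) (ω : MultiCfg (F.P q.K) (SU N) (FluctV N)),
      (θ.Zh q m Ω Λ).quad j Λ' ω = ∑ b ∈ (Set.toFinite (bondsIn j (Λ'ᶜ ∩ Ω (j + 1)))).toFinset, ‖(ω j).2 b‖ ^ 2)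
    (hrec : θ.Provisos₁₃CoPH F N) (σ : Sect3Supplier θ p) (hσ : SupplierObligations θ p σ) (hops : OperandRowsAlongChain θ p σ) :
    ∀ k, k ≤ p.K → SLaw₁₃CoPH F N θ p k := by
  obtain ⟨⟨θ₁, Zr⟩, Zh, Phih⟩ := θ
  obtain rfl : θ₁ = _ := hθ
  exact sLaw₁₃CoPH_all_of_obligations hrec rfl hθ₀.liveRepin₁₃ hκ hE₀ hB₀ hM σ hσ
    (noExpansionObligation_of_gaussCert_of_operandRows hζ hq hrec hM σ hσ.loc hops)

/-- **★ [III]'s THEOREM OF p. 245 AS PRINTED, `B14.ThmP245PrintedI T ρ S Scorr K`, AT ANY H-EXTENSION OF A LIVE RE-PIN** — for any family `T` of renormalization transformations on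
the run's lattices agreeing with the tower of record on the trajectory — from `hrec`, `hσ`, `hT` (p596032's `thmP245PrintedI_of_obligations`; this seat's R134 row).
[cite: Balaban1988Convergent, Theorem p.245, Thm 1 p.262, remark p.262, (3.25) p.270, §3 p.279] -/
theorem thmP245PrintedI_liveRepinH_of_obligations (hθ : θ.toStage13Params = θ₀.liveRepin₁₃ F N) (hθ₀ : θ₀.Admissible F N)
    (hκ : 0 ≤ θ₀.s2.lf.κ) (hE₀ : 0 ≤ θ₀.s2.lf.E₀) (hB₀ : 0 ≤ θ₀.s2.lf.B₀) (hM : 1 ≤ θ₀.τ9.M) (hrec : θ.Provisos₁₃CoPH F N) (σ : Sect3Supplier θ p)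
    (hσ : SupplierObligations θ p σ) (hT : NoExpansionObligation θ p σ)
    (T : (k : ℕ) → RTOpI (F.P p.K) k (SU N) (avOfRecord F N p.K k))
    (hTT : ∀ k, k < p.K → (T k).T (densOfRecord₁₃ F N θ.toStage13Params p k) = tdensOfRecord₁₃ F N θ.toStage13Params p k) :
    B14.ThmP245PrintedI T (densOfRecord₁₃ F N θ.toStage13Params p) (VOfRecord₁₃CoPH F N θ p).S (VOfRecord₁₃CoPH F N θ p).Scorr p.K := by
  obtain ⟨⟨θ₁, Zr⟩, Zh, Phih⟩ := θ
  obtain rfl : θ₁ = _ := hθ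
  exact thmP245PrintedI_of_obligations hrec rfl hθ₀.liveRepin₁₃ hκ hE₀ hB₀ hM σ hσ hT T hTT

end Repin

/-! ## §2  At K0a's ALL-NUMERICS witness family `theta13LiveOfNumerics F N n ε₂₉ ζ Rz Zt` (= `(theta13OfNumerics …).liveRepin₁₃`, `rfl`): `n.Pos`, `0 < ε₂₉`, the three signs and `1 ≤ M` of `n` -/

section Numerics

variable {n : Stage12Numerics} {ε₂₉ : ℝ} {ζ : ZetaOfRecord F N n.ν n.τ9.M} {Rz : (K : ℕ) → Sect2.Residual (F.P K) (MatA N)}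
  {Zt : (K : ℕ) → TkResidualW F N (FluctV N) K} {θ : Stage13HParams F N} {p : B12.RunParams}

/-- **★ THEOREM 1 OF [III], ALL LEVELS, AT ANY H-EXTENSION OF THE ALL-NUMERICS WITNESS `θ₁₃(n, ε₂₉)`** from `hrec`, `hσ`, `hT`; admissibility is K0a's
`admissible_theta13OfNumerics` (`n.Pos`, `0 < ε₂₉`), the selector clause `rfl`. [cite: Balaban1988Convergent, Thm 1 p.262, Theorem p.245, §3 p.279, (2.4) p.255, (2.10) p.256; Balaban1989LargeFieldI, (0.3)–(0.4) p.176, p.177 (i)–(ii)] -/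
theorem sLaw₁₃CoPH_all_theta13LiveOfNumericsH_of_obligations (hθ : θ.toStage13Params = theta13LiveOfNumerics F N n ε₂₉ ζ Rz Zt) (hn : n.Pos) (hε' : 0 < ε₂₉)
    (hκ : 0 ≤ n.s2.lf.κ) (hE₀ : 0 ≤ n.s2.lf.E₀) (hB₀ : 0 ≤ n.s2.lf.B₀) (hM : 1 ≤ n.τ9.M) (hrec : θ.Provisos₁₃CoPH F N) (σ : Sect3Supplier θ p)
    (hσ : SupplierObligations θ p σ) (hT : NoExpansionObligation θ p σ) : ∀ k, k ≤ p.K → SLaw₁₃CoPH F N θ p k :=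
  sLaw₁₃CoPH_all_liveRepinH_of_obligations (θ₀ := theta13OfNumerics F N n ε₂₉ ζ Rz Zt) hθ (admissible_theta13OfNumerics F N ζ Rz Zt hn hε') hκ hE₀ hB₀ hM hrec σ hσ hT

/-- **★ THE 𝐓-IMAGES AT ANY H-EXTENSION OF `θ₁₃(n, ε₂₉)`** from `hrec`, `hσ`, `hT`. [cite: Balaban1988Convergent, Theorem p.245, remark p.262, §3 p.279, (3.25) p.270; Balaban1989LargeFieldI, (0.3)–(0.4) p.176] -/
theorem tLaw₁₃CoPH_all_theta13LiveOfNumericsH_of_obligations (hθ : θ.toStage13Params = theta13LiveOfNumerics F N n ε₂₉ ζ Rz Zt) (hn : n.Pos) (hε' : 0 < ε₂₉)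
    (hκ : 0 ≤ n.s2.lf.κ) (hE₀ : 0 ≤ n.s2.lf.E₀) (hB₀ : 0 ≤ n.s2.lf.B₀) (hM : 1 ≤ n.τ9.M) (hrec : θ.Provisos₁₃CoPH F N) (σ : Sect3Supplier θ p)
    (hσ : SupplierObligations θ p σ) (hT : NoExpansionObligation θ p σ) : ∀ k, k < p.K → TLaw₁₃CoPH F N θ p k :=
  tLaw₁₃CoPH_all_liveRepinH_of_obligations (θ₀ := theta13OfNumerics F N n ε₂₉ ζ Rz Zt) hθ (admissible_theta13OfNumerics F N ζ Rz Zt hn hε') hκ hE₀ hB₀ hM hrec σ hσ hT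

/-- **★★ THE `hT` BINDER — THEOREM p. 245 IN LAW FORM ALONG EVERY RUN — AT ANY H-EXTENSION OF `θ₁₃(n, ε₂₉)` FROM `hrec` AND `∀ P, SupplyChainAt θ P`.**
[cite: Balaban1988Convergent, Theorem p.245, Thm 1 p.262, remark p.262, §3 p.279; Balaban1989LargeFieldI, (0.3)–(0.4) p.176] -/
theorem thmP245Laws_all_theta13LiveOfNumericsH_of_supplyChainAt (hθ : θ.toStage13Params = theta13LiveOfNumerics F N n ε₂₉ ζ Rz Zt) (hn : n.Pos) (hε' : 0 < ε₂₉)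
    (hκ : 0 ≤ n.s2.lf.κ) (hE₀ : 0 ≤ n.s2.lf.E₀) (hB₀ : 0 ≤ n.s2.lf.B₀) (hM : 1 ≤ n.τ9.M) (hrec : θ.Provisos₁₃CoPH F N)
    (hN : ∀ P : B12.RunParams, SupplyChainAt θ P) :
    ∀ (P : B12.RunParams) (k : ℕ), k < P.K → SLaw₁₃CoPH F N θ P k → TLaw₁₃CoPH F N θ P k :=
  thmP245Laws_all_liveRepinH_of_supplyChainAt (θ₀ := theta13OfNumerics F N n ε₂₉ ζ Rz Zt) hθ (admissible_theta13OfNumerics F N ζ Rz Zt hn hε') hκ hE₀ hB₀ hM hrec hN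

/-- **★ N11's NODE `Dag.B14_main (leavesP w p)` AT EVERY WORLD BOUND TO THE DATUM OF AN H-EXTENSION OF `θ₁₃(n, ε₂₉)`** — `βup`, `β₀`, `γ`, `b`, `L`, `up` unread.
[cite: Balaban1988Convergent, Thm 1 p.262, Theorem p.245, p.244 L36–38, (2.6) p.255; Balaban1989LargeFieldII, Thm 1 p.355 (bookkeeping)] -/
theorem b14_main_theta13LiveOfNumericsH_of_obligations (hθ : θ.toStage13Params = theta13LiveOfNumerics F N n ε₂₉ ζ Rz Zt) (hn : n.Pos) (hε' : 0 < ε₂₉)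
    (hκ : 0 ≤ n.s2.lf.κ) (hE₀ : 0 ≤ n.s2.lf.E₀) (hB₀ : 0 ≤ n.s2.lf.B₀) (hM : 1 ≤ n.τ9.M) (hrec : θ.Provisos₁₃CoPH F N) (σ : Sect3Supplier θ p)
    (hσ : SupplierObligations θ p σ) (hT : NoExpansionObligation θ p σ) (w : WorldP) (hC : w.C = (datumOfRecord₁₃CoPH F N θ hrec).C) :
    Dag.B14_main (leavesP w p) :=
  b14_main_liveRepinH_of_obligations (θ₀ := theta13OfNumerics F N n ε₂₉ ζ Rz Zt) hθ (admissible_theta13OfNumerics F N ζ Rz Zt hn hε') hκ hE₀ hB₀ hM hrec σ hσ hT w hC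

/-- **★ THEOREM 1 OF [III] AT ANY H-EXTENSION OF `θ₁₃(n, ε₂₉)` FROM `hrec`, `ZhUnity`, THE SUPPLIER's OBLIGATIONS AND THE ROWS.**
[cite: Balaban1988Convergent, Thm 1 p.262, Theorem p.245, (3.24)–(3.25) p.270, (3.16)–(3.22) pp.268–269, (1.11) p.248; Balaban1989LargeFieldI, (0.3)–(0.4) p.176] -/
theorem sLaw₁₃CoPH_all_theta13LiveOfNumericsH_of_obligations_of_rows (hθ : θ.toStage13Params = theta13LiveOfNumerics F N n ε₂₉ ζ Rz Zt) (hn : n.Pos) (hε' : 0 < ε₂₉)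
    (hκ : 0 ≤ n.s2.lf.κ) (hE₀ : 0 ≤ n.s2.lf.E₀) (hB₀ : 0 ≤ n.s2.lf.B₀) (hM : 1 ≤ n.τ9.M) (hrec : θ.Provisos₁₃CoPH F N) (hU : θ.ZhUnity F N)
    (σ : Sect3Supplier θ p) (hσ : SupplierObligations θ p σ) (hres : ResidualRows θ p) (hops : OperandRowsAlongChain θ p σ) :
    ∀ k, k ≤ p.K → SLaw₁₃CoPH F N θ p k :=
  sLaw₁₃CoPH_all_liveRepinH_of_obligations_of_rows (θ₀ := theta13OfNumerics F N n ε₂₉ ζ Rz Zt) hθ (admissible_theta13OfNumerics F N ζ Rz Zt hn hε') hκ hE₀ hB₀ hM hrec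
    hU σ hσ hres hops

/-- **★★ THEOREM 1 OF [III] AT ANY H-EXTENSION OF `θ₁₃(n, ε₂₉)` IN THE GAUSSIAN-CERTIFICATE CLASS** from `hrec`, `SupplierObligations`, `OperandRowsAlongChain` — nothing else.
[cite: Balaban1988Convergent, Thm 1 p.262, Theorem p.245, (3.23)–(3.25) p.270, (1.11) p.248, (2.23) p.258; Balaban1989LargeFieldI, (0.3)–(0.4) p.176] -/
theorem sLaw₁₃CoPH_all_theta13LiveOfNumericsH_gaussCert_of_obligations_of_operandRows (hθ : θ.toStage13Params = theta13LiveOfNumerics F N n ε₂₉ ζ Rz Zt)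
    (hn : n.Pos) (hε' : 0 < ε₂₉) (hκ : 0 ≤ n.s2.lf.κ) (hE₀ : 0 ≤ n.s2.lf.E₀) (hB₀ : 0 ≤ n.s2.lf.B₀) (hM : 1 ≤ n.τ9.M)
    (hζ : ∀ (q : B12.RunParams) (m : ℕ) (Ω Λ : ℕ → Set (Site (F.P q.K) 0)), (θ.Zh q m Ω Λ).ζ0 = (ZhPinOfRecord₁₃ θ.toStage13Params q Ω Λ).ζ0)
    (hq : ∀ (q : B12.RunParams) (m : ℕ) (Ω Λ : ℕ → Set (Site (F.P q.K) 0)) (j : ℕ) (Λ' : Set (Site (F.P q.K) 0)) (ω : MultiCfg (F.P q.K) (SU N) (FluctV N)),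
      (θ.Zh q m Ω Λ).quad j Λ' ω = ∑ b ∈ (Set.toFinite (bondsIn j (Λ'ᶜ ∩ Ω (j + 1)))).toFinset, ‖(ω j).2 b‖ ^ 2)
    (hrec : θ.Provisos₁₃CoPH F N) (σ : Sect3Supplier θ p) (hσ : SupplierObligations θ p σ) (hops : OperandRowsAlongChain θ p σ) :
    ∀ k, k ≤ p.K → SLaw₁₃CoPH F N θ p k :=
  sLaw₁₃CoPH_all_liveRepinH_gaussCert_of_obligations_of_operandRows (θ₀ := theta13OfNumerics F N n ε₂₉ ζ Rz Zt) hθ (admissible_theta13OfNumerics F N ζ Rz Zt hn hε')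
    hκ hE₀ hB₀ hM hζ hq hrec σ hσ hops

/-- **★ [III]'s THEOREM OF p. 245 AS PRINTED AT ANY H-EXTENSION OF `θ₁₃(n, ε₂₉)`** for any `T`-family agreeing with the tower, from `hrec`, `hσ`, `hT`.
[cite: Balaban1988Convergent, Theorem p.245, Thm 1 p.262, remark p.262, (3.25) p.270, §3 p.279] -/
theorem thmP245PrintedI_theta13LiveOfNumericsH_of_obligations (hθ : θ.toStage13Params = theta13LiveOfNumerics F N n ε₂₉ ζ Rz Zt) (hn : n.Pos) (hε' : 0 < ε₂₉)
    (hκ : 0 ≤ n.s2.lf.κ) (hE₀ : 0 ≤ n.s2.lf.E₀) (hB₀ : 0 ≤ n.s2.lf.B₀) (hM : 1 ≤ n.τ9.M) (hrec : θ.Provisos₁₃CoPH F N) (σ : Sect3Supplier θ p)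
    (hσ : SupplierObligations θ p σ) (hT : NoExpansionObligation θ p σ)
    (T : (k : ℕ) → RTOpI (F.P p.K) k (SU N) (avOfRecord F N p.K k))
    (hTT : ∀ k, k < p.K → (T k).T (densOfRecord₁₃ F N θ.toStage13Params p k) = tdensOfRecord₁₃ F N θ.toStage13Params p k) :
    B14.ThmP245PrintedI T (densOfRecord₁₃ F N θ.toStage13Params p) (VOfRecord₁₃CoPH F N θ p).S (VOfRecord₁₃CoPH F N θ p).Scorr p.K :=
  thmP245PrintedI_liveRepinH_of_obligations (θ₀ := theta13OfNumerics F N n ε₂₉ ζ Rz Zt) hθ (admissible_theta13OfNumerics F N ζ Rz Zt hn hε') hκ hE₀ hB₀ hM hrec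
    σ hσ hT T hTT

end Numerics

/-! ## §3  At K1's witness of record `θ₁₅ᶜᶜᴹᵂ(j; γ) = theta13OfThm1CCMW F N j γ ε₀ ε₂₉ B₃ B₃' a₀ a₁`: the window `0 < γ ≤ ½` and the six signs ONLY — `κ = 2·10⁴`, `E₀ = B₀ = 1`, `M = L^j` numerals -/

section K1Witness

variable {j : ℕ} {γ ε₀ ε₂₉ B₃ B₃' a₀ a₁ : ℝ} {θ : Stage13HParams F N} {p : B12.RunParams}

/-- `1 ≤ M = L^j` at dag-n21-c's collared numerics (`stage12NumericsOfThm1CCMW_τ9_M`, `1 < L`). [cite: Balaban1989LargeFieldI, (2.1) p.182; Balaban1987RG1, (1.12) p.262 (bookkeeping)] -/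
theorem one_le_M_stage12NumericsOfThm1CCMW (F : T4Family) (j : ℕ) (γ ε₀ B₃ B₃' a₀ a₁ : ℝ) :
    1 ≤ (stage12NumericsOfThm1CCMW F.L j γ ε₀ B₃ B₃' a₀ a₁).τ9.M := by
  rw [stage12NumericsOfThm1CCMW_τ9_M]
  exact Nat.one_le_pow _ _ (lt_trans Nat.zero_lt_one F.hL.2)

/-- **★ THEOREM 1 OF [III], ALL LEVELS, ALL HISTORIES, AT ANY H-EXTENSION OF K1's WITNESS `θ₁₅ᶜᶜᴹᵂ(j; γ)`** from `hrec`, `hσ`, `hT` — the window `0 < γ ≤ ½` and the six admissibility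
signs ONLY (`admissible_theta13OfNumerics` at `stage12NumericsOfThm1CCMW_pos_of_le_half`; `κ = 2·10⁴`, `E₀ = B₀ = 1`, `M = L^j ≥ 1` numerals; selector `rfl`).
[cite: Balaban1988Convergent, Thm 1 p.262, Theorem p.245, §3 p.279, (2.4) p.255, (2.10) p.256; Balaban1987RG1, Thm 1 p.259; Balaban1989LargeFieldI, (0.3)–(0.4) p.176, p.177 (i)–(ii)] -/
theorem sLaw₁₃CoPH_all_theta13OfThm1CCMWH_of_obligations (hθ : θ.toStage13Params = theta13OfThm1CCMW F N j γ ε₀ ε₂₉ B₃ B₃' a₀ a₁) (hγ₀ : 0 < γ) (hγh : γ ≤ 1 / 2)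
    (hε : 0 < ε₀) (hε' : 0 < ε₂₉) (hB : 0 ≤ B₃) (hB' : 0 ≤ B₃') (ha₀ : 0 < a₀) (ha₁ : 0 < a₁) (hrec : θ.Provisos₁₃CoPH F N) (σ : Sect3Supplier θ p)
    (hσ : SupplierObligations θ p σ) (hT : NoExpansionObligation θ p σ) : ∀ k, k ≤ p.K → SLaw₁₃CoPH F N θ p k :=
  sLaw₁₃CoPH_all_theta13LiveOfNumericsH_of_obligations hθ (stage12NumericsOfThm1CCMW_pos_of_le_half F.hL.2.le hγ₀ hγh hε hB hB' ha₀ ha₁) hε'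
    (by rw [show (stage12NumericsOfThm1CCMW F.L j γ ε₀ B₃ B₃' a₀ a₁).s2.lf.κ = 20000 from rfl]; norm_num)
    (by rw [show (stage12NumericsOfThm1CCMW F.L j γ ε₀ B₃ B₃' a₀ a₁).s2.lf.E₀ = 1 from rfl]; norm_num)
    (by rw [show (stage12NumericsOfThm1CCMW F.L j γ ε₀ B₃ B₃' a₀ a₁).s2.lf.B₀ = 1 from rfl]; norm_num)
    (one_le_M_stage12NumericsOfThm1CCMW F j γ ε₀ B₃ B₃' a₀ a₁) hrec σ hσ hT

/-- **★ THE 𝐓-IMAGES `∀ k < K, TLaw₁₃CoPH θ p k` AT ANY H-EXTENSION OF `θ₁₅ᶜᶜᴹᵂ(j; γ)`** from `hrec`, `hσ`, `hT` (window + six signs).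
[cite: Balaban1988Convergent, Theorem p.245, remark p.262, §3 p.279, (3.25) p.270; Balaban1987RG1, Thm 1 p.259; Balaban1989LargeFieldI, (0.3)–(0.4) p.176] -/
theorem tLaw₁₃CoPH_all_theta13OfThm1CCMWH_of_obligations (hθ : θ.toStage13Params = theta13OfThm1CCMW F N j γ ε₀ ε₂₉ B₃ B₃' a₀ a₁) (hγ₀ : 0 < γ) (hγh : γ ≤ 1 / 2)
    (hε : 0 < ε₀) (hε' : 0 < ε₂₉) (hB : 0 ≤ B₃) (hB' : 0 ≤ B₃') (ha₀ : 0 < a₀) (ha₁ : 0 < a₁) (hrec : θ.Provisos₁₃CoPH F N) (σ : Sect3Supplier θ p)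
    (hσ : SupplierObligations θ p σ) (hT : NoExpansionObligation θ p σ) : ∀ k, k < p.K → TLaw₁₃CoPH F N θ p k :=
  tLaw₁₃CoPH_all_theta13LiveOfNumericsH_of_obligations hθ (stage12NumericsOfThm1CCMW_pos_of_le_half F.hL.2.le hγ₀ hγh hε hB hB' ha₀ ha₁) hε'
    (by rw [show (stage12NumericsOfThm1CCMW F.L j γ ε₀ B₃ B₃' a₀ a₁).s2.lf.κ = 20000 from rfl]; norm_num)
    (by rw [show (stage12NumericsOfThm1CCMW F.L j γ ε₀ B₃ B₃' a₀ a₁).s2.lf.E₀ = 1 from rfl]; norm_num)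
    (by rw [show (stage12NumericsOfThm1CCMW F.L j γ ε₀ B₃ B₃' a₀ a₁).s2.lf.B₀ = 1 from rfl]; norm_num)
    (one_le_M_stage12NumericsOfThm1CCMW F j γ ε₀ B₃ B₃' a₀ a₁) hrec σ hσ hT

/-- **★★ THE `hT` BINDER OF dag-n24-c's `N24_h11_theta13OfThm1CCMW_of_thmP245_laws` AT ANY H-EXTENSION OF `θ₁₅ᶜᶜᴹᵂ(j; γ)` FROM `hrec` AND `∀ P, SupplyChainAt θ P`** — window + six
signs only. [cite: Balaban1988Convergent, Theorem p.245, Thm 1 p.262, remark p.262, §3 p.279; Balaban1987RG1, Thm 1 p.259; Balaban1989LargeFieldI, (0.3)–(0.4) p.176] -/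
theorem thmP245Laws_all_theta13OfThm1CCMWH_of_supplyChainAt (hθ : θ.toStage13Params = theta13OfThm1CCMW F N j γ ε₀ ε₂₉ B₃ B₃' a₀ a₁) (hγ₀ : 0 < γ) (hγh : γ ≤ 1 / 2)
    (hε : 0 < ε₀) (hε' : 0 < ε₂₉) (hB : 0 ≤ B₃) (hB' : 0 ≤ B₃') (ha₀ : 0 < a₀) (ha₁ : 0 < a₁) (hrec : θ.Provisos₁₃CoPH F N)
    (hN : ∀ P : B12.RunParams, SupplyChainAt θ P) :
    ∀ (P : B12.RunParams) (k : ℕ), k < P.K → SLaw₁₃CoPH F N θ P k → TLaw₁₃CoPH F N θ P k :=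
  thmP245Laws_all_theta13LiveOfNumericsH_of_supplyChainAt hθ (stage12NumericsOfThm1CCMW_pos_of_le_half F.hL.2.le hγ₀ hγh hε hB hB' ha₀ ha₁) hε'
    (by rw [show (stage12NumericsOfThm1CCMW F.L j γ ε₀ B₃ B₃' a₀ a₁).s2.lf.κ = 20000 from rfl]; norm_num)
    (by rw [show (stage12NumericsOfThm1CCMW F.L j γ ε₀ B₃ B₃' a₀ a₁).s2.lf.E₀ = 1 from rfl]; norm_num)
    (by rw [show (stage12NumericsOfThm1CCMW F.L j γ ε₀ B₃ B₃' a₀ a₁).s2.lf.B₀ = 1 from rfl]; norm_num)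
    (one_le_M_stage12NumericsOfThm1CCMW F j γ ε₀ B₃ B₃' a₀ a₁) hrec hN

/-- **★ N11's NODE `Dag.B14_main (leavesP w p)` AT EVERY WORLD BOUND TO THE DATUM OF AN H-EXTENSION OF `θ₁₅ᶜᶜᴹᵂ(j; γ)`** — `βup`, `β₀`, `γ`, `b`, `L`, `up` unread (the K1 world's
ceiling letter is free on this road). [cite: Balaban1988Convergent, Thm 1 p.262, Theorem p.245, p.244 L36–38, (2.6) p.255; Balaban1987RG1, Thm 1 p.259; Balaban1989LargeFieldII, Thm 1 p.355 (bookkeeping)] -/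
theorem b14_main_theta13OfThm1CCMWH_of_obligations (hθ : θ.toStage13Params = theta13OfThm1CCMW F N j γ ε₀ ε₂₉ B₃ B₃' a₀ a₁) (hγ₀ : 0 < γ) (hγh : γ ≤ 1 / 2)
    (hε : 0 < ε₀) (hε' : 0 < ε₂₉) (hB : 0 ≤ B₃) (hB' : 0 ≤ B₃') (ha₀ : 0 < a₀) (ha₁ : 0 < a₁) (hrec : θ.Provisos₁₃CoPH F N) (σ : Sect3Supplier θ p)
    (hσ : SupplierObligations θ p σ) (hT : NoExpansionObligation θ p σ) (w : WorldP) (hC : w.C = (datumOfRecord₁₃CoPH F N θ hrec).C) :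
    Dag.B14_main (leavesP w p) :=
  b14_main_theta13LiveOfNumericsH_of_obligations hθ (stage12NumericsOfThm1CCMW_pos_of_le_half F.hL.2.le hγ₀ hγh hε hB hB' ha₀ ha₁) hε'
    (by rw [show (stage12NumericsOfThm1CCMW F.L j γ ε₀ B₃ B₃' a₀ a₁).s2.lf.κ = 20000 from rfl]; norm_num)
    (by rw [show (stage12NumericsOfThm1CCMW F.L j γ ε₀ B₃ B₃' a₀ a₁).s2.lf.E₀ = 1 from rfl]; norm_num)
    (by rw [show (stage12NumericsOfThm1CCMW F.L j γ ε₀ B₃ B₃' a₀ a₁).s2.lf.B₀ = 1 from rfl]; norm_num)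
    (one_le_M_stage12NumericsOfThm1CCMW F j γ ε₀ B₃ B₃' a₀ a₁) hrec σ hσ hT w hC

/-- **★ THEOREM 1 OF [III] AT ANY H-EXTENSION OF `θ₁₅ᶜᶜᴹᵂ(j; γ)` FROM `hrec`, `ZhUnity`, THE SUPPLIER's OBLIGATIONS AND THE ROWS.**
[cite: Balaban1988Convergent, Thm 1 p.262, Theorem p.245, (3.24)–(3.25) p.270, (3.16)–(3.22) pp.268–269, (1.11) p.248; Balaban1987RG1, Thm 1 p.259; Balaban1989LargeFieldI, (0.3)–(0.4) p.176] -/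
theorem sLaw₁₃CoPH_all_theta13OfThm1CCMWH_of_obligations_of_rows (hθ : θ.toStage13Params = theta13OfThm1CCMW F N j γ ε₀ ε₂₉ B₃ B₃' a₀ a₁) (hγ₀ : 0 < γ) (hγh : γ ≤ 1 / 2)
    (hε : 0 < ε₀) (hε' : 0 < ε₂₉) (hB : 0 ≤ B₃) (hB' : 0 ≤ B₃') (ha₀ : 0 < a₀) (ha₁ : 0 < a₁) (hrec : θ.Provisos₁₃CoPH F N) (hU : θ.ZhUnity F N)
    (σ : Sect3Supplier θ p) (hσ : SupplierObligations θ p σ) (hres : ResidualRows θ p) (hops : OperandRowsAlongChain θ p σ) :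
    ∀ k, k ≤ p.K → SLaw₁₃CoPH F N θ p k :=
  sLaw₁₃CoPH_all_theta13LiveOfNumericsH_of_obligations_of_rows hθ (stage12NumericsOfThm1CCMW_pos_of_le_half F.hL.2.le hγ₀ hγh hε hB hB' ha₀ ha₁) hε'
    (by rw [show (stage12NumericsOfThm1CCMW F.L j γ ε₀ B₃ B₃' a₀ a₁).s2.lf.κ = 20000 from rfl]; norm_num)
    (by rw [show (stage12NumericsOfThm1CCMW F.L j γ ε₀ B₃ B₃' a₀ a₁).s2.lf.E₀ = 1 from rfl]; norm_num)
    (by rw [show (stage12NumericsOfThm1CCMW F.L j γ ε₀ B₃ B₃' a₀ a₁).s2.lf.B₀ = 1 from rfl]; norm_num)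
    (one_le_M_stage12NumericsOfThm1CCMW F j γ ε₀ B₃ B₃' a₀ a₁) hrec hU σ hσ hres hops

/-- **★★ THEOREM 1 OF [III] AT ANY H-EXTENSION OF `θ₁₅ᶜᶜᴹᵂ(j; γ)` IN THE GAUSSIAN-CERTIFICATE CLASS** from `hrec`, `SupplierObligations`, `OperandRowsAlongChain` — nothing else.
[cite: Balaban1988Convergent, Thm 1 p.262, Theorem p.245, (3.23)–(3.25) p.270, (1.11) p.248, (2.23) p.258; Balaban1987RG1, Thm 1 p.259; Balaban1989LargeFieldI, (0.3)–(0.4) p.176] -/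
theorem sLaw₁₃CoPH_all_theta13OfThm1CCMWH_gaussCert_of_obligations_of_operandRows (hθ : θ.toStage13Params = theta13OfThm1CCMW F N j γ ε₀ ε₂₉ B₃ B₃' a₀ a₁)
    (hγ₀ : 0 < γ) (hγh : γ ≤ 1 / 2) (hε : 0 < ε₀) (hε' : 0 < ε₂₉) (hB : 0 ≤ B₃) (hB' : 0 ≤ B₃') (ha₀ : 0 < a₀) (ha₁ : 0 < a₁)
    (hζ : ∀ (q : B12.RunParams) (m : ℕ) (Ω Λ : ℕ → Set (Site (F.P q.K) 0)), (θ.Zh q m Ω Λ).ζ0 = (ZhPinOfRecord₁₃ θ.toStage13Params q Ω Λ).ζ0)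
    (hq : ∀ (q : B12.RunParams) (m : ℕ) (Ω Λ : ℕ → Set (Site (F.P q.K) 0)) (j' : ℕ) (Λ' : Set (Site (F.P q.K) 0)) (ω : MultiCfg (F.P q.K) (SU N) (FluctV N)),
      (θ.Zh q m Ω Λ).quad j' Λ' ω = ∑ b ∈ (Set.toFinite (bondsIn j' (Λ'ᶜ ∩ Ω (j' + 1)))).toFinset, ‖(ω j').2 b‖ ^ 2)
    (hrec : θ.Provisos₁₃CoPH F N) (σ : Sect3Supplier θ p) (hσ : SupplierObligations θ p σ) (hops : OperandRowsAlongChain θ p σ) :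
    ∀ k, k ≤ p.K → SLaw₁₃CoPH F N θ p k :=
  sLaw₁₃CoPH_all_theta13LiveOfNumericsH_gaussCert_of_obligations_of_operandRows hθ (stage12NumericsOfThm1CCMW_pos_of_le_half F.hL.2.le hγ₀ hγh hε hB hB' ha₀ ha₁) hε'
    (by rw [show (stage12NumericsOfThm1CCMW F.L j γ ε₀ B₃ B₃' a₀ a₁).s2.lf.κ = 20000 from rfl]; norm_num)
    (by rw [show (stage12NumericsOfThm1CCMW F.L j γ ε₀ B₃ B₃' a₀ a₁).s2.lf.E₀ = 1 from rfl]; norm_num)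
    (by rw [show (stage12NumericsOfThm1CCMW F.L j γ ε₀ B₃ B₃' a₀ a₁).s2.lf.B₀ = 1 from rfl]; norm_num)
    (one_le_M_stage12NumericsOfThm1CCMW F j γ ε₀ B₃ B₃' a₀ a₁) hζ hq hrec σ hσ hops

/-- **★ [III]'s THEOREM OF p. 245 AS PRINTED, `B14.ThmP245PrintedI (T) ρ S Scorr K`, AT ANY H-EXTENSION OF `θ₁₅ᶜᶜᴹᵂ(j; γ)`** — for any family `T` of renormalization transformations on the
run's lattices agreeing with the tower of record on the trajectory (dag-n24-c §2's `h245` per run) — from `hrec`, `hσ`, `hT`; window + six signs only.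
[cite: Balaban1988Convergent, Theorem p.245, Thm 1 p.262, remark p.262, (3.25) p.270, §3 p.279; Balaban1987RG1, Thm 1 p.259] -/
theorem thmP245PrintedI_theta13OfThm1CCMWH_of_obligations (hθ : θ.toStage13Params = theta13OfThm1CCMW F N j γ ε₀ ε₂₉ B₃ B₃' a₀ a₁) (hγ₀ : 0 < γ) (hγh : γ ≤ 1 / 2)
    (hε : 0 < ε₀) (hε' : 0 < ε₂₉) (hB : 0 ≤ B₃) (hB' : 0 ≤ B₃') (ha₀ : 0 < a₀) (ha₁ : 0 < a₁) (hrec : θ.Provisos₁₃CoPH F N) (σ : Sect3Supplier θ p)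
    (hσ : SupplierObligations θ p σ) (hT : NoExpansionObligation θ p σ)
    (T : (k : ℕ) → RTOpI (F.P p.K) k (SU N) (avOfRecord F N p.K k))
    (hTT : ∀ k, k < p.K → (T k).T (densOfRecord₁₃ F N θ.toStage13Params p k) = tdensOfRecord₁₃ F N θ.toStage13Params p k) :
    B14.ThmP245PrintedI T (densOfRecord₁₃ F N θ.toStage13Params p) (VOfRecord₁₃CoPH F N θ p).S (VOfRecord₁₃CoPH F N θ p).Scorr p.K :=
  thmP245PrintedI_theta13LiveOfNumericsH_of_obligations hθ (stage12NumericsOfThm1CCMW_pos_of_le_half F.hL.2.le hγ₀ hγh hε hB hB' ha₀ ha₁) hε'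
    (by rw [show (stage12NumericsOfThm1CCMW F.L j γ ε₀ B₃ B₃' a₀ a₁).s2.lf.κ = 20000 from rfl]; norm_num)
    (by rw [show (stage12NumericsOfThm1CCMW F.L j γ ε₀ B₃ B₃' a₀ a₁).s2.lf.E₀ = 1 from rfl]; norm_num)
    (by rw [show (stage12NumericsOfThm1CCMW F.L j γ ε₀ B₃ B₃' a₀ a₁).s2.lf.B₀ = 1 from rfl]; norm_num)
    (one_le_M_stage12NumericsOfThm1CCMW F j γ ε₀ B₃ B₃' a₀ a₁) hrec σ hσ hT T hTT

/-! ### §3b  dag-n24-c 34H §1's `hT` binder at the LITERAL `Stage13HParams.ofHistoryBlind F N ⟨θ₁₅ᶜᶜᴹᵂ, Zr⟩` (any run-indexed residual `Zr`; dag-n24-c: `Zr := ZrOfRecord₁₃ F N θ₁₅ᶜᶜᴹᵂ`)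
LOCATED: at this literal parameter the history-indexed slot is `Zh p n Ω Λ := Zr p` (history-BLIND), so the displayed `NoExpansionObligation` ∕ `ResidualRows` there are pinned to the
all-large diagonal (dag-n11-d p538518 `not_exists_historyBlind_pointwise_pin`); the tree discharges them in the ZhPin class — see §3c (`gaussPinH`) for the dischargeable key. -/

variable (Zr : (q : B12.RunParams) → TkResidualW F N (FluctV N) q.K)

/-- **★★★ N11's SUPPLY OF dag-n24-c's `hT` BINDER AT K1's WITNESS, BY NAME**: at `θᴴ := Stage13HParams.ofHistoryBlind F N ⟨theta13OfThm1CCMW F N j γ ε₀ ε₂₉ B₃ B₃' a₀ a₁, Zr⟩`,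
`∀ P k, k < P.K → SLaw₁₃CoPH θᴴ P k → TLaw₁₃CoPH θᴴ P k` FROM `hrec : θᴴ.Provisos₁₃CoPH` (the `.toCore` of dag-n24-c's door provisos) AND `∀ P, SupplyChainAt θᴴ P` (N11's one-token
residual: ∃ supplier with `SupplierObligations` ([III] §3) ∧ `NoExpansionObligation`) — window `0 < γ ≤ ½` + six signs, NOTHING ELSE.
[cite: Balaban1988Convergent, Theorem p.245, Thm 1 p.262, remark p.262, §3 p.279, (2.4)–(2.6) p.255; Balaban1987RG1, Thm 1 p.259; Balaban1989LargeFieldI, (0.2)–(0.4) p.176] -/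
theorem thmP245Laws_all_ofHistoryBlind_theta13OfThm1CCMW_of_supplyChainAt (hγ₀ : 0 < γ) (hγh : γ ≤ 1 / 2)
    (hε : 0 < ε₀) (hε' : 0 < ε₂₉) (hB : 0 ≤ B₃) (hB' : 0 ≤ B₃') (ha₀ : 0 < a₀) (ha₁ : 0 < a₁)
    (hrec : (Stage13HParams.ofHistoryBlind F N ⟨theta13OfThm1CCMW F N j γ ε₀ ε₂₉ B₃ B₃' a₀ a₁, Zr⟩).Provisos₁₃CoPH F N)
    (hN : ∀ P : B12.RunParams, SupplyChainAt (Stage13HParams.ofHistoryBlind F N ⟨theta13OfThm1CCMW F N j γ ε₀ ε₂₉ B₃ B₃' a₀ a₁, Zr⟩) P) :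
    ∀ (P : B12.RunParams) (k : ℕ), k < P.K →
      SLaw₁₃CoPH F N (Stage13HParams.ofHistoryBlind F N ⟨theta13OfThm1CCMW F N j γ ε₀ ε₂₉ B₃ B₃' a₀ a₁, Zr⟩) P k →
        TLaw₁₃CoPH F N (Stage13HParams.ofHistoryBlind F N ⟨theta13OfThm1CCMW F N j γ ε₀ ε₂₉ B₃ B₃' a₀ a₁, Zr⟩) P k :=
  thmP245Laws_all_theta13OfThm1CCMWH_of_supplyChainAt rfl hγ₀ hγh hε hε' hB hB' ha₀ ha₁ hrec hN

/-- **★★ THE SAME `hT` BINDER FROM A SUPPLIER PER RUN WITH ITS OBLIGATIONS, `ZhUnity` AND THE ROWS** (`ResidualRows` witness-free, `OperandRowsAlongChain` — the no-expansion obligation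
DISCHARGED). [cite: Balaban1988Convergent, Theorem p.245, Thm 1 p.262, (3.24)–(3.25) p.270, (3.16)–(3.22) pp.268–269; Balaban1987RG1, Thm 1 p.259; Balaban1989LargeFieldI, (0.2)–(0.4) p.176] -/
theorem thmP245Laws_all_ofHistoryBlind_theta13OfThm1CCMW_of_obligations_of_rows (hγ₀ : 0 < γ) (hγh : γ ≤ 1 / 2)
    (hε : 0 < ε₀) (hε' : 0 < ε₂₉) (hB : 0 ≤ B₃) (hB' : 0 ≤ B₃') (ha₀ : 0 < a₀) (ha₁ : 0 < a₁)
    (hrec : (Stage13HParams.ofHistoryBlind F N ⟨theta13OfThm1CCMW F N j γ ε₀ ε₂₉ B₃ B₃' a₀ a₁, Zr⟩).Provisos₁₃CoPH F N)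
    (hU : (Stage13HParams.ofHistoryBlind F N ⟨theta13OfThm1CCMW F N j γ ε₀ ε₂₉ B₃ B₃' a₀ a₁, Zr⟩).ZhUnity F N)
    (σ : (P : B12.RunParams) → Sect3Supplier (Stage13HParams.ofHistoryBlind F N ⟨theta13OfThm1CCMW F N j γ ε₀ ε₂₉ B₃ B₃' a₀ a₁, Zr⟩) P)
    (hσ : ∀ P, SupplierObligations (Stage13HParams.ofHistoryBlind F N ⟨theta13OfThm1CCMW F N j γ ε₀ ε₂₉ B₃ B₃' a₀ a₁, Zr⟩) P (σ P))
    (hres : ∀ P, ResidualRows (Stage13HParams.ofHistoryBlind F N ⟨theta13OfThm1CCMW F N j γ ε₀ ε₂₉ B₃ B₃' a₀ a₁, Zr⟩) P)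
    (hops : ∀ P, OperandRowsAlongChain (Stage13HParams.ofHistoryBlind F N ⟨theta13OfThm1CCMW F N j γ ε₀ ε₂₉ B₃ B₃' a₀ a₁, Zr⟩) P (σ P)) :
    ∀ (P : B12.RunParams) (k : ℕ), k < P.K →
      SLaw₁₃CoPH F N (Stage13HParams.ofHistoryBlind F N ⟨theta13OfThm1CCMW F N j γ ε₀ ε₂₉ B₃ B₃' a₀ a₁, Zr⟩) P k →
        TLaw₁₃CoPH F N (Stage13HParams.ofHistoryBlind F N ⟨theta13OfThm1CCMW F N j γ ε₀ ε₂₉ B₃ B₃' a₀ a₁, Zr⟩) P k :=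
  fun P => thmP245Laws_all_theta13OfThm1CCMWH_of_supplyChainAt (θ := Stage13HParams.ofHistoryBlind F N ⟨theta13OfThm1CCMW F N j γ ε₀ ε₂₉ B₃ B₃' a₀ a₁, Zr⟩) rfl
    hγ₀ hγh hε hε' hB hB' ha₀ ha₁ hrec (fun Q => ⟨σ Q, hσ Q, noExpansionObligation_of_residualRows_of_operandRows hrec hU
      (one_le_M_stage12NumericsOfThm1CCMW F j γ ε₀ B₃ B₃' a₀ a₁) (σ Q) (hσ Q).loc (hres Q) (hops Q)⟩) P

/-! ### §3c  At dag-n11-w1's NAMED GAUSSIAN CERTIFICATE `gaussPinH θ` of ANY H-extension `θ` of `θ₁₅ᶜᶜᴹᵂ(j; γ)` (Stage-13 part unchanged, `gaussPinH_toStage13Params`): the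
no-expansion half DISCHARGED from def-T's operand rows along the chain — N11's K1-facing residual there = `hrec` + `SupplierObligations` + `OperandRowsAlongChain`, nothing else.
(At the bare history-blind `Stage13HParams.ofHistoryBlind F N ⟨θ₁₅ᶜᶜᴹᵂ, ZrOfRecord₁₃ F N θ₁₅ᶜᶜᴹᵂ⟩` the slot `Zh` is K0a's diagonal pin, which serves the no-expansion clause along
the all-large diagonal only — dag-n11-d `…HistoryPinnedResidualDefs` header, p538518 `not_exists_historyBlind_pointwise_pin`; hence §3c ∕ `rePinH` are where the tree discharges it.) -/

/-- **★★ THEOREM 1 OF [III], ALL LEVELS, AT `gaussPinH θ` FOR ANY H-EXTENSION `θ` OF K1's WITNESS `θ₁₅ᶜᶜᴹᵂ(j; γ)`** from `hrec : θ.Provisos₁₃CoPH` (dag-n11-w1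
`provisos₁₃CoPH_gaussPinH`), a supplier AT `gaussPinH θ` with its obligations and def-T's operand rows along its chain — window + six signs; NO `NoExpansionObligation`, NO `ZhUnity`,
NO residual ∕ K0b row. [cite: Balaban1988Convergent, Thm 1 p.262, Theorem p.245, (3.23)–(3.25) p.270, (2.21) p.258, (1.11) p.248; Balaban1987RG1, Thm 1 p.259; Balaban1989LargeFieldI, (0.2)–(0.4) p.176] -/
theorem sLaw₁₃CoPH_all_gaussPinH_theta13OfThm1CCMWH_of_obligations_of_operandRows (hθ : θ.toStage13Params = theta13OfThm1CCMW F N j γ ε₀ ε₂₉ B₃ B₃' a₀ a₁)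
    (hγ₀ : 0 < γ) (hγh : γ ≤ 1 / 2) (hε : 0 < ε₀) (hε' : 0 < ε₂₉) (hB : 0 ≤ B₃) (hB' : 0 ≤ B₃') (ha₀ : 0 < a₀) (ha₁ : 0 < a₁) (hrec : θ.Provisos₁₃CoPH F N)
    (σ : Sect3Supplier (gaussPinH θ) p) (hσ : SupplierObligations (gaussPinH θ) p σ) (hops : OperandRowsAlongChain (gaussPinH θ) p σ) :
    ∀ k, k ≤ p.K → SLaw₁₃CoPH F N (gaussPinH θ) p k := by
  obtain ⟨⟨θ₁, Zr⟩, Zh, Phih⟩ := θ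
  obtain rfl : θ₁ = _ := hθ
  exact sLaw₁₃CoPH_all_theta13OfThm1CCMWH_gaussCert_of_obligations_of_operandRows (θ := gaussPinH _) rfl hγ₀ hγh hε hε' hB hB' ha₀ ha₁ (gaussPinH_ζ0 _) (gaussPinH_quad _)
    (provisos₁₃CoPH_gaussPinH hrec) σ hσ hops

/-- **★★★ THE `hT` BINDER AT `gaussPinH θ` FOR ANY H-EXTENSION `θ` OF K1's WITNESS `θ₁₅ᶜᶜᴹᵂ(j; γ)` — N11's K1-FACING RESIDUAL THERE IS `hrec` + [III] §3's SUPPLIER OBLIGATIONS + def-T's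
OPERAND ROWS, NOTHING ELSE**: `∀ P k, k < P.K → SLaw₁₃CoPH (gaussPinH θ) P k → TLaw₁₃CoPH (gaussPinH θ) P k` from `hrec : θ.Provisos₁₃CoPH`, a supplier per run AT `gaussPinH θ`
with `SupplierObligations` and `OperandRowsAlongChain` — window + six signs (e.g. `θ := Stage13HParams.ofHistoryBlind F N ⟨θ₁₅ᶜᶜᴹᵂ, Zr⟩`, `hθ := rfl`).
[cite: Balaban1988Convergent, Theorem p.245, Thm 1 p.262, remark p.262, §3 p.279, (3.23)–(3.25) p.270, (2.21) p.258; Balaban1987RG1, Thm 1 p.259; Balaban1989LargeFieldI, (0.2)–(0.4) p.176] -/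
theorem thmP245Laws_all_gaussPinH_theta13OfThm1CCMWH_of_obligations_of_operandRows (hθ : θ.toStage13Params = theta13OfThm1CCMW F N j γ ε₀ ε₂₉ B₃ B₃' a₀ a₁)
    (hγ₀ : 0 < γ) (hγh : γ ≤ 1 / 2) (hε : 0 < ε₀) (hε' : 0 < ε₂₉) (hB : 0 ≤ B₃) (hB' : 0 ≤ B₃') (ha₀ : 0 < a₀) (ha₁ : 0 < a₁) (hrec : θ.Provisos₁₃CoPH F N)
    (σ : (P : B12.RunParams) → Sect3Supplier (gaussPinH θ) P) (hσ : ∀ P, SupplierObligations (gaussPinH θ) P (σ P))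
    (hops : ∀ P, OperandRowsAlongChain (gaussPinH θ) P (σ P)) :
    ∀ (P : B12.RunParams) (k : ℕ), k < P.K → SLaw₁₃CoPH F N (gaussPinH θ) P k → TLaw₁₃CoPH F N (gaussPinH θ) P k := by
  obtain ⟨⟨θ₁, Zr⟩, Zh, Phih⟩ := θ
  obtain rfl : θ₁ = _ := hθ
  exact fun P k hk _ => tLaw₁₃CoPH_all_theta13OfThm1CCMWH_of_obligations (θ := gaussPinH _) rfl hγ₀ hγh hε hε' hB hB' ha₀ ha₁ (provisos₁₃CoPH_gaussPinH hrec) (σ P) (hσ P)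
    (noExpansionObligation_of_gaussCert_of_operandRows (gaussPinH_ζ0 _) (gaussPinH_quad _) (provisos₁₃CoPH_gaussPinH hrec)
      (one_le_M_stage12NumericsOfThm1CCMW F j γ ε₀ B₃ B₃' a₀ a₁) (σ P) (hσ P).loc (hops P)) k hk

end K1Witness

end Summit.QuantumFields.YangMills.Theorems.BalabanUVNodesN11Sect3SupplyChainNodeAtNumerics

end
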